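import Summits.Ventures.PercRepro.C041SquareMarksA

/-!
# EVERY MARKED VERTEX AGAINST EVERY DEFORMED LEAF — the triangle `X(p,q) × v b` is in the cone for all marks and
all fugacities `b ∈ [0, 1]` (mine-3, gen 60; C-041.md §21 (aj))

The two-parameter families with a CONTINUOUS parameter: for a marked vertex of shape `O1 = X(p,0)`, `O2 = X(0,q)` or
`D = X(p,q)` (`p, q ≥ 1`) and the fugacity-deformed leaf `v b`, the output `θ_△(X, v b)` is linear in the shifted mark
variables `sh n = 2^n − 2` and quadratic in `b`.  An exact LP over coefficients that are polynomial in `sh p, sh q`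
(non-negative coefficients) and BERNSTEIN-quadratic in `b` (non-negative Bernstein coefficients) — with the generators
allowed to depend on `b` through the atoms `b`, `1 − b`, the MIDPOINT `(1 + b) / 2` and `b / 2` beside `0, 1, ½, ⅓, ⅔`
(mining/mine-3/tools/g60/markleaf.py, markleaf5.py) — gives one identity per shape (10 / 10 / 23 generators; the
midpoint atom is what the fixed atoms lacked: without it even `X(2,0) × v b` is infeasible).  THEOREM
(`InCone_thetaTri_marks_v`): for ALL `p, q ≥ 0` and ALL `b ∈ [0, 1]` the triangle with `X(p,q)` and `v b` at its exits
lies in the cone (the unmarked shape by the apex lemma); hence every two-exit cycle carrying a marked vertex and a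
deformed leaf (`InCone_thetaCyc_marks_v`).  The `X(1,1) × v b` case is `C041TriangleLeafFamily` again, now with the
midpoint atom in place of fifteen generators.  Behind the families: `X(p,q) = X(1,1) + sh p · e_{T₁} + sh q · e_{T₂}`, and
THE RAYS AGAINST A LEAF are cone members (`InCone_thetaTri_eT1_v`, `InCone_thetaTri_eT2_v`: four generators each).
-/

namespace PercRepro

namespace RelaxedTriangle

open TreeClosure

/-- **THE MARKED-VERTEX × LEAF IDENTITY, shape `O1`** (`sh n = 2^n − 2`; coefficients polynomial in the shifted
mark variables with Bernstein-quadratic dependence on the fugacity `b`, all coefficients non-negative). -/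
theorem thetaTri_pow_one_v (p : ℕ) (hp : 1 ≤ p) (b : ℝ) :
    thetaTri (v 1 ^ p) (v b) =
      ((13 / 8 : ℝ) * (1 - b) * (1 - b) + (2 : ℝ) * sh p * b * (1 - b)
          + (2 : ℝ) * sh p * b * b) • v 1
      + ((15 / 8 : ℝ) * (1 - b) * (1 - b)) • (v 0 * v 1)
      + ((1 : ℝ) * (1 - b) * (1 - b) + (17 / 8 : ℝ) * b * (1 - b) + (4 : ℝ) * b * b) • (1 : Vec6)
      + ((27 / 16 : ℝ) * (1 - b) * (1 - b)) • v (2 / 3)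
      + ((15 / 16 : ℝ) * b * (1 - b) + (15 / 8 : ℝ) * b * b + (1 : ℝ) * sh p * b * b) • (v 1 * v 1)
      + ((13 / 2 : ℝ) * (1 - b) * (1 - b) + (59 / 4 : ℝ) * b * (1 - b)
          + (33 / 4 : ℝ) * b * b) • v ((1 + b) / 2)
      + ((35 / 16 : ℝ) * (1 - b) * (1 - b) + (63 / 16 : ℝ) * b * (1 - b)
          + (7 / 4 : ℝ) * b * b) • v b
      + ((1 / 8 : ℝ) * (1 - b) * (1 - b) + (1 / 4 : ℝ) * b * (1 - b)
          + (1 / 8 : ℝ) * b * b) • (v 1 * v b)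
      + ((2 : ℝ) * sh p * (1 - b) * (1 - b) + (4 : ℝ) * sh p * b * (1 - b)
          + (2 : ℝ) * sh p * b * b) • (v 1 * v ((1 + b) / 2))
      + ((2 : ℝ) * sh p * (1 - b) * (1 - b)) • (v 1 * v (1 / 2)) := by
  rw [pow_v_one_eq p hp]
  ext i
  simp only [thetaTri_eq_vec, Pi.add_apply, Pi.smul_apply, Pi.mul_apply, Pi.one_apply, smul_eq_mul, v, sh]
  fin_cases i <;> simp <;> ring

/-- The triangle with a marked vertex of shape `O1` and a deformed leaf `v b` lies in the cone, every `b ∈ [0, 1]`. -/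
theorem InCone_thetaTri_pow_one_v (p : ℕ) (hp : 1 ≤ p) (b : ℝ) (hb : 0 ≤ b ∧ b ≤ 1) :
    InCone (thetaTri (v 1 ^ p) (v b)) := by
  rw [thetaTri_pow_one_v p hp b]
  have hb0 : 0 ≤ b := hb.1
  have hb1 : 0 ≤ 1 - b := by linarith [hb.2]
  have hb1b : 0 ≤ 1 - b ∧ 1 - b ≤ 1 := ⟨hb1, by linarith [hb.1]⟩
  have hbm : 0 ≤ (1 + b) / 2 ∧ (1 + b) / 2 ≤ 1 := ⟨by linarith, by linarith [hb.2]⟩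
  have hbh : 0 ≤ b / 2 ∧ b / 2 ≤ 1 := ⟨by linarith, by linarith [hb.2]⟩
  have hsp : 0 ≤ sh p := sh_nonneg p hp
  exact (((((((((InCone.smul _ (by positivity) (InCone_v1)).add
    (InCone.smul _ (by positivity) ((InCone_v0).mul (InCone_v1)))).add
    (InCone.smul _ (by positivity) InCone_one)).add
    (InCone.smul _ (by positivity) (InCone_v_twothirds))).add
    (InCone.smul _ (by positivity) ((InCone_v1).mul (InCone_v1)))).add
    (InCone.smul _ (by positivity) (InCone_v ((1 + b) / 2) hbm))).add
    (InCone.smul _ (by positivity) (InCone_v b hb))).add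
    (InCone.smul _ (by positivity) ((InCone_v1).mul (InCone_v b hb)))).add
    (InCone.smul _ (by positivity) ((InCone_v1).mul (InCone_v ((1 + b) / 2) hbm)))).add
    (InCone.smul _ (by positivity) ((InCone_v1).mul (InCone_vh)))

/-- **THE MARKED-VERTEX × LEAF IDENTITY, shape `O2`** (`sh n = 2^n − 2`; coefficients polynomial in the shifted
mark variables with Bernstein-quadratic dependence on the fugacity `b`, all coefficients non-negative). -/
theorem thetaTri_pow_zero_v (q : ℕ) (hq : 1 ≤ q) (b : ℝ) :
    thetaTri (v 0 ^ q) (v b) =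
      ((33 / 4 : ℝ) * (1 - b) * (1 - b) + (59 / 4 : ℝ) * b * (1 - b)
          + (13 / 2 : ℝ) * b * b) • v (b / 2)
      + ((4 : ℝ) * (1 - b) * (1 - b) + (17 / 8 : ℝ) * b * (1 - b) + (1 : ℝ) * b * b) • (1 : Vec6)
      + ((15 / 8 : ℝ) * (1 - b) * (1 - b) + (15 / 16 : ℝ) * b * (1 - b)
          + (1 : ℝ) * sh q * (1 - b) * (1 - b)) • (v 0 * v 0)
      + ((15 / 8 : ℝ) * b * b) • (v 0 * v 1)
      + ((1 / 8 : ℝ) * (1 - b) * (1 - b) + (1 / 4 : ℝ) * b * (1 - b)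
          + (1 / 8 : ℝ) * b * b) • (v 0 * v b)
      + ((27 / 16 : ℝ) * b * b) • v (1 / 3)
      + ((13 / 8 : ℝ) * b * b + (2 : ℝ) * sh q * (1 - b) * (1 - b)
          + (2 : ℝ) * sh q * b * (1 - b)) • v 0
      + ((7 / 4 : ℝ) * (1 - b) * (1 - b) + (63 / 16 : ℝ) * b * (1 - b)
          + (35 / 16 : ℝ) * b * b) • v b
      + ((2 : ℝ) * sh q * b * b) • (v 0 * v (1 / 2))
      + ((2 : ℝ) * sh q * (1 - b) * (1 - b) + (4 : ℝ) * sh q * b * (1 - b)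
          + (2 : ℝ) * sh q * b * b) • (v 0 * v (b / 2)) := by
  rw [pow_v_zero_eq q hq]
  ext i
  simp only [thetaTri_eq_vec, Pi.add_apply, Pi.smul_apply, Pi.mul_apply, Pi.one_apply, smul_eq_mul, v, sh]
  fin_cases i <;> simp <;> ring

/-- The triangle with a marked vertex of shape `O2` and a deformed leaf `v b` lies in the cone, every `b ∈ [0, 1]`. -/
theorem InCone_thetaTri_pow_zero_v (q : ℕ) (hq : 1 ≤ q) (b : ℝ) (hb : 0 ≤ b ∧ b ≤ 1) :
    InCone (thetaTri (v 0 ^ q) (v b)) := by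
  rw [thetaTri_pow_zero_v q hq b]
  have hb0 : 0 ≤ b := hb.1
  have hb1 : 0 ≤ 1 - b := by linarith [hb.2]
  have hb1b : 0 ≤ 1 - b ∧ 1 - b ≤ 1 := ⟨hb1, by linarith [hb.1]⟩
  have hbm : 0 ≤ (1 + b) / 2 ∧ (1 + b) / 2 ≤ 1 := ⟨by linarith, by linarith [hb.2]⟩
  have hbh : 0 ≤ b / 2 ∧ b / 2 ≤ 1 := ⟨by linarith, by linarith [hb.2]⟩
  have hsq : 0 ≤ sh q := sh_nonneg q hq
  exact (((((((((InCone.smul _ (by positivity) (InCone_v (b / 2) hbh)).add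
    (InCone.smul _ (by positivity) InCone_one)).add
    (InCone.smul _ (by positivity) ((InCone_v0).mul (InCone_v0)))).add
    (InCone.smul _ (by positivity) ((InCone_v0).mul (InCone_v1)))).add
    (InCone.smul _ (by positivity) ((InCone_v0).mul (InCone_v b hb)))).add
    (InCone.smul _ (by positivity) (InCone_v_third))).add
    (InCone.smul _ (by positivity) (InCone_v0))).add
    (InCone.smul _ (by positivity) (InCone_v b hb))).add
    (InCone.smul _ (by positivity) ((InCone_v0).mul (InCone_vh)))).add
    (InCone.smul _ (by positivity) ((InCone_v0).mul (InCone_v (b / 2) hbh)))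

/-- **THE MARKED-VERTEX × LEAF IDENTITY, shape `D`** (`sh n = 2^n − 2`; coefficients polynomial in the shifted
mark variables with Bernstein-quadratic dependence on the fugacity `b`, all coefficients non-negative). -/
theorem thetaTri_marks_v' (p q : ℕ) (hp : 1 ≤ p) (hq : 1 ≤ q) (b : ℝ) :
    thetaTri (v 1 ^ p * v 0 ^ q) (v b) =
      ((16 / 27 : ℝ) * b * b) • (v 1 * v (b / 2))
      + ((466 / 117 : ℝ) * (1 - b) * (1 - b) + (3886 / 351 : ℝ) * b * (1 - b)
          + (466 / 117 : ℝ) * b * b) • v (1 / 2)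
      + ((376 / 117 : ℝ) * (1 - b) * (1 - b) + (4136 / 351 : ℝ) * b * (1 - b)
          + (376 / 117 : ℝ) * b * b) • (v (1 / 2) * v (1 / 2))
      + ((175 / 117 : ℝ) * (1 - b) * (1 - b) + (790 / 351 : ℝ) * b * (1 - b)
          + (175 / 117 : ℝ) * b * b) • v b
      + ((172 / 39 : ℝ) * b * b) • (v 1 * v (1 / 3))
      + ((76 / 351 : ℝ) * b * b) • (v 1 * v (1 - b))
      + ((16 / 27 : ℝ) * (1 - b) * (1 - b)) • (v 0 * v ((1 + b) / 2))
      + ((220 / 117 : ℝ) * (1 - b) * (1 - b) + (2 : ℝ) * sh q * b * b) • (v 0 * v (1 / 2))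
      + ((47 / 13 : ℝ) * (1 - b) * (1 - b)) • v (1 / 3)
      + ((47 / 13 : ℝ) * b * b) • v (2 / 3)
      + ((16 / 27 : ℝ) * (1 - b) * (1 - b)) • (v 0 * v b)
      + ((16 / 27 : ℝ) * b * b) • (v 1 * v b)
      + ((172 / 39 : ℝ) * (1 - b) * (1 - b)) • (v 0 * v (2 / 3))
      + ((112 / 39 : ℝ) * b * (1 - b)) • (v (1 / 2) * v b)
      + ((8 / 351 : ℝ) * b * (1 - b)) • v (1 - b)
      + ((220 / 117 : ℝ) * b * b + (2 : ℝ) * sh p * (1 - b) * (1 - b)) • (v 1 * v (1 / 2))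
      + ((76 / 351 : ℝ) * (1 - b) * (1 - b)) • (v 0 * v (1 - b))
      + ((2 : ℝ) * sh q * (1 - b) * (1 - b) + (2 : ℝ) * sh q * b * (1 - b)) • v 0
      + ((1 : ℝ) * sh q * (1 - b) * (1 - b)) • (v 0 * v 0)
      + ((2 : ℝ) * sh q * (1 - b) * (1 - b) + (4 : ℝ) * sh q * b * (1 - b)
          + (2 : ℝ) * sh q * b * b) • (v 0 * v (b / 2))
      + ((2 : ℝ) * sh p * b * (1 - b) + (2 : ℝ) * sh p * b * b) • v 1
      + ((2 : ℝ) * sh p * (1 - b) * (1 - b) + (4 : ℝ) * sh p * b * (1 - b)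
          + (2 : ℝ) * sh p * b * b) • (v 1 * v ((1 + b) / 2))
      + ((1 : ℝ) * sh p * b * b) • (v 1 * v 1) := by
  rw [pow_v_one_mul_pow_v_zero_eq p q hp hq]
  ext i
  simp only [thetaTri_eq_vec, Pi.add_apply, Pi.smul_apply, Pi.mul_apply, smul_eq_mul, v, sh]
  fin_cases i <;> simp <;> ring

/-- The triangle with a marked vertex of shape `D` and a deformed leaf `v b` lies in the cone, every `b ∈ [0, 1]`. -/
theorem InCone_thetaTri_marks_v' (p q : ℕ) (hp : 1 ≤ p) (hq : 1 ≤ q) (b : ℝ) (hb : 0 ≤ b ∧ b ≤ 1) :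
    InCone (thetaTri (v 1 ^ p * v 0 ^ q) (v b)) := by
  rw [thetaTri_marks_v' p q hp hq b]
  have hb0 : 0 ≤ b := hb.1
  have hb1 : 0 ≤ 1 - b := by linarith [hb.2]
  have hb1b : 0 ≤ 1 - b ∧ 1 - b ≤ 1 := ⟨hb1, by linarith [hb.1]⟩
  have hbm : 0 ≤ (1 + b) / 2 ∧ (1 + b) / 2 ≤ 1 := ⟨by linarith, by linarith [hb.2]⟩
  have hbh : 0 ≤ b / 2 ∧ b / 2 ≤ 1 := ⟨by linarith, by linarith [hb.2]⟩
  have hsp : 0 ≤ sh p := sh_nonneg p hp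
  have hsq : 0 ≤ sh q := sh_nonneg q hq
  exact ((((((((((((((((((((((InCone.smul _ (by positivity) ((InCone_v1).mul (InCone_v (b / 2) hbh))).add
    (InCone.smul _ (by positivity) (InCone_vh))).add
    (InCone.smul _ (by positivity) ((InCone_vh).mul (InCone_vh)))).add
    (InCone.smul _ (by positivity) (InCone_v b hb))).add
    (InCone.smul _ (by positivity) ((InCone_v1).mul (InCone_v_third)))).add
    (InCone.smul _ (by positivity) ((InCone_v1).mul (InCone_v (1 - b) hb1b)))).add
    (InCone.smul _ (by positivity) ((InCone_v0).mul (InCone_v ((1 + b) / 2) hbm)))).add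
    (InCone.smul _ (by positivity) ((InCone_v0).mul (InCone_vh)))).add
    (InCone.smul _ (by positivity) (InCone_v_third))).add
    (InCone.smul _ (by positivity) (InCone_v_twothirds))).add
    (InCone.smul _ (by positivity) ((InCone_v0).mul (InCone_v b hb)))).add
    (InCone.smul _ (by positivity) ((InCone_v1).mul (InCone_v b hb)))).add
    (InCone.smul _ (by positivity) ((InCone_v0).mul (InCone_v_twothirds)))).add
    (InCone.smul _ (by positivity) ((InCone_vh).mul (InCone_v b hb)))).add
    (InCone.smul _ (by positivity) (InCone_v (1 - b) hb1b))).add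
    (InCone.smul _ (by positivity) ((InCone_v1).mul (InCone_vh)))).add
    (InCone.smul _ (by positivity) ((InCone_v0).mul (InCone_v (1 - b) hb1b)))).add
    (InCone.smul _ (by positivity) (InCone_v0))).add
    (InCone.smul _ (by positivity) ((InCone_v0).mul (InCone_v0)))).add
    (InCone.smul _ (by positivity) ((InCone_v0).mul (InCone_v (b / 2) hbh)))).add
    (InCone.smul _ (by positivity) (InCone_v1))).add
    (InCone.smul _ (by positivity) ((InCone_v1).mul (InCone_v ((1 + b) / 2) hbm)))).add
    (InCone.smul _ (by positivity) ((InCone_v1).mul (InCone_v1)))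

/-- **THEOREM (TRIANGLE, any marked vertex × any deformed leaf)**: for all `p, q ≥ 0` and `b ∈ [0, 1]`,
`θ_△(X(p,q), v b)` lies in the cone. -/
theorem InCone_thetaTri_marks_v (p q : ℕ) (b : ℝ) (hb : 0 ≤ b ∧ b ≤ 1) :
    InCone (thetaTri (v 1 ^ p * v 0 ^ q) (v b)) := by
  by_cases hp : p = 0
  · subst hp
    by_cases hq : q = 0
    · subst hq
      simp only [pow_zero, mul_one]
      rw [thetaTri_comm]
      exact InCone_thetaTri_one (InCone_v b hb)
    · simp only [pow_zero, one_mul]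
      exact InCone_thetaTri_pow_zero_v q (Nat.one_le_iff_ne_zero.mpr hq) b hb
  · by_cases hq : q = 0
    · subst hq
      simp only [pow_zero, mul_one]
      exact InCone_thetaTri_pow_one_v p (Nat.one_le_iff_ne_zero.mpr hp) b hb
    · exact InCone_thetaTri_marks_v' p q (Nat.one_le_iff_ne_zero.mpr hp) (Nat.one_le_iff_ne_zero.mpr hq) b hb

/-- The mirror `θ_△(v b, X(p,q))`. -/
theorem InCone_thetaTri_v_marks (p q : ℕ) (b : ℝ) (hb : 0 ≤ b ∧ b ≤ 1) :
    InCone (thetaTri (v b) (v 1 ^ p * v 0 ^ q)) := by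
  rw [thetaTri_comm]
  exact InCone_thetaTri_marks_v p q b hb

/-- **Every two-exit cycle carrying a marked vertex and a deformed leaf lies in the cone** (any marks, any
`b ∈ [0, 1]`, any multiplicities). -/
theorem InCone_thetaCyc_marks_v (p₀ q₀ : ℕ) (b : ℝ) (hb : 0 ≤ b ∧ b ≤ 1) {p q s : ℝ} (hp : 0 ≤ p) (hq : 0 ≤ q)
    (hs : 0 ≤ s) : InCone (thetaCyc p q s (v 1 ^ p₀ * v 0 ^ q₀) (v b)) :=
  InCone_thetaCyc_of_InCone_tri ((InCone_pow_v_one p₀).mul (InCone_pow_v_zero q₀)) (InCone_v b hb)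
    (InCone_thetaTri_marks_v p₀ q₀ b hb) hp hq hs

/-! ## The rays against a leaf -/

/-- **THE RAY AGAINST A LEAF**: the ray `e_{T₁} = (0, 1, 0, 0, 0, 0)` (one valid type-1 state; not a cone member)
against the deformed leaf `v b`: `θ_△(e_{T₁}, v b) = 2b·v 1 + b²·X(2,0) + 2·v 1 * v ((1 + b)/2) + 2(1 − b)²·v 1 * v ½`
— the `sh p`-part of the `X(p,0) × v b` identity, since `X(p,0) = v 1 + sh p · e_{T₁}`. -/
theorem thetaTri_eT1_v (b : ℝ) :
    thetaTri ![0, 1, 0, 0, 0, 0] (v b) = (2 * b) • v 1 + (b * b) • (v 1 * v 1) + (2 : ℝ) • (v 1 * v ((1 + b) / 2))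
      + (2 * (1 - b) * (1 - b)) • (v 1 * v (1 / 2)) := by
  ext i
  simp only [thetaTri_eq_vec, Pi.add_apply, Pi.smul_apply, Pi.mul_apply, smul_eq_mul, v]
  fin_cases i <;> simp <;> ring

/-- The mirror: `θ_△(e_{T₂}, v b) = 2(1 − b)·v 0 + (1 − b)²·X(0,2) + 2·v 0 * v (b/2) + 2b²·v 0 * v ½`. -/
theorem thetaTri_eT2_v (b : ℝ) :
    thetaTri ![0, 0, 1, 0, 0, 0] (v b) = (2 * (1 - b)) • v 0 + ((1 - b) * (1 - b)) • (v 0 * v 0)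
      + (2 : ℝ) • (v 0 * v (b / 2)) + (2 * b * b) • (v 0 * v (1 / 2)) := by
  ext i
  simp only [thetaTri_eq_vec, Pi.add_apply, Pi.smul_apply, Pi.mul_apply, smul_eq_mul, v]
  fin_cases i <;> simp <;> ring

/-- The ray `e_{T₁}` against any deformed leaf gives a cone member. -/
theorem InCone_thetaTri_eT1_v (b : ℝ) (hb : 0 ≤ b ∧ b ≤ 1) : InCone (thetaTri ![0, 1, 0, 0, 0, 0] (v b)) := by
  rw [thetaTri_eT1_v]
  have hb0 : 0 ≤ b := hb.1
  have hb1 : 0 ≤ 1 - b := by linarith [hb.2]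
  have hbm : 0 ≤ (1 + b) / 2 ∧ (1 + b) / 2 ≤ 1 := ⟨by linarith, by linarith [hb.2]⟩
  exact (((InCone.smul _ (by positivity) InCone_v1).add (InCone.smul _ (by positivity) (InCone_v1.mul InCone_v1))).add
    (InCone.smul _ (by norm_num) (InCone_v1.mul (InCone_v _ hbm)))).add
    (InCone.smul _ (by positivity) (InCone_v1.mul InCone_vh))

/-- The ray `e_{T₂}` against any deformed leaf gives a cone member. -/
theorem InCone_thetaTri_eT2_v (b : ℝ) (hb : 0 ≤ b ∧ b ≤ 1) : InCone (thetaTri ![0, 0, 1, 0, 0, 0] (v b)) := by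
  rw [thetaTri_eT2_v]
  have hb0 : 0 ≤ b := hb.1
  have hb1 : 0 ≤ 1 - b := by linarith [hb.2]
  have hbh : 0 ≤ b / 2 ∧ b / 2 ≤ 1 := ⟨by linarith, by linarith [hb.2]⟩
  exact (((InCone.smul _ (by positivity) InCone_v0).add (InCone.smul _ (by positivity) (InCone_v0.mul InCone_v0))).add
    (InCone.smul _ (by norm_num) (InCone_v0.mul (InCone_v _ hbh)))).add
    (InCone.smul _ (by positivity) (InCone_v0.mul InCone_vh))

end RelaxedTriangle

end PercRepro
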